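import Literature.NumberTheory.EllipticCurves.ThetaChiFour
import Literature.NumberTheory.EllipticCurves.TunnellWeightTwoThetaProductsProofs
import Literature.NumberTheory.EllipticCurves.ThetaAutomorphyClosure
import HarnessLib

/-!
# `φ₆₄ = ½ Θ′ θ₄`: the CM newform of the congruent number curve `E₂ : 2y² = x³ - x` (64a) as a cusp form on `Γ₀(64)`

[[cite: Shimura1973HalfIntegral, §1–§2]] [[cite: Tunnell1983Congruent, p. 326]] — with
`Θ′(z) = ∑ χ₋₄(n) n e(n²z)` (`ThetaChiFour`, weight `3/2`) and `θ₄(z) = θ(4z)` (weight `1/2`),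
`φ₆₄ := ½ Θ′ θ₄` has the `q`-expansion `q + 2q⁵ - 3q⁹ - 6q¹³ + 2q¹⁷ - … = ∑ (2/m) S(m) q^m`
(`S(m)` the primary sum over `ℤ[i]`; `= η(8z)³ θ(4z) = η(8z)⁸/(η(4z)²η(16z)²)`, the newform of 64a —
the `q`-expansion identity is the sequel) and is the weight-`2` input of the Shintani-lift route to
`tunnell_converse_even`.  We PROVE:

* `thetaChi_smul_eq_tsum_general` — the transformation formula of `Θ′` for EVERY `γ` with `c > 0`
  (classes modulo `4c`), used for the cusp conditions;
* `mdifferentiable_thetaChi` — holomorphy (uniform convergence on half-planes,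
  Mathlib `Complex.differentiableOn_tsum_of_summable_norm`);
* `isThetaAutomorphic_thetaChi` — **`Θ′ ∈` weight `3/2`, level `64`, trivial character** in the
  tree's `IsThetaAutomorphic` sense (`Θ′(γz)θ(z)³ = θ(γz)³Θ′(z)`), from the mixed law of
  `ThetaChiFour` and `θ(γz)² = χ₋₄(d)(cz+d)θ(z)²`; `c < 0` via `-γ`, `c = 0` by periodicity;
* `isZeroAtImInfty_slashSq_thetaChi` — cusp decay `Θ′(gz)²/(cz+d)³ → 0` at `i∞` for all
  `g ∈ SL₂(ℤ)` (`|Θ′(gz)| ≤ C|cz+d|^{3/2} e^{-π Im z/32}` from the general formula; no constant term);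
* `thetaChi_mem_halfIntCuspForms : Θ′ ∈ S_{3/2}(64, 1)`, `thetaMul_four_mem_halfIntModularForms_64 :
  θ₄ ∈ M_{1/2}(64, 1)`, hence `phi64_mem_halfIntCuspForms : φ₆₄ ∈ S_{4/2}(64, 1)` (the tree's
  `mul_mem_halfIntCuspForms`) and **`phi64CuspForm : CuspForm (Gamma0 64) 2`** (the tree's
  `cuspFormTwoOfMem`).

Everything is proved; the only definitions are `phi64`, `phi64CuspForm`.
-/

noncomputable section

open scoped MatrixGroups Manifold

open UpperHalfPlane hiding I
open Complex Filter Topology CongruenceSubgroup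

namespace Literature.NumberTheory.EllipticCurves.ModularForms

open Literature.NumberTheory.EllipticCurves.Tunnell1983

/-! ### A. The transformation formula for every `c > 0` (classes modulo `4c`) -/

section General

variable {c : ℕ} [NeZero c]

omit [NeZero c] in
/-- `4 ∣ 4c`. [folklore] -/
theorem four_dvd_four_mul : 4 ∣ 4 * c := dvd_mul_right 4 c

/-- `neZero_four_mul'` (auxiliary). [folklore] -/
instance neZero_four_mul' : NeZero (4 * c) := ⟨by have := NeZero.ne c; omega⟩

/-- **`Θ′(γz)` for every `γ = (a b; c d)` with `c > 0`** (Poisson on the classes modulo `4c`):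
`Θ′(γz) = -(w/8) (32ic/w)^{-1/2} ∑_k k exp(πi k² w/(32c)) G_χ(4a, k; 4c)`, `w = cz + d`.
[cite: Shimura1973HalfIntegral, §2] -/
theorem thetaChi_smul_eq_tsum_general {γ : SL(2, ℤ)} (hc : (γ 1 0 : ℤ) = c) (z : ℍ) :
    thetaChi (γ • z) =
      -(((c : ℂ) * z + γ 1 1) / 8) * (1 / (32 * I * c / ((c : ℂ) * z + γ 1 1)) ^ (1 / 2 : ℂ)) *
        ∑' k : ℤ, (k : ℂ) * cexp (Real.pi * I * k ^ 2 * (((c : ℂ) * z + γ 1 1) / (32 * c))) *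
          chiGaussSum (c := 4 * c) four_dvd_four_mul ((4 * γ 0 0 : ℤ) : ZMod (4 * c)) k := by
  -- notation
  set a : ℤ := γ 0 0 with ha
  set b : ℤ := γ 0 1 with hb
  set d : ℤ := γ 1 1 with hd
  set w : ℂ := (c : ℂ) * z + d with hw
  have hc0 : (c : ℂ) ≠ 0 := Nat.cast_ne_zero.mpr (NeZero.ne c)
  have hcR : (0 : ℝ) < c := Nat.cast_pos.mpr (Nat.pos_of_ne_zero (NeZero.ne c))
  have hw_im : 0 < w.im := im_denom_pos d z
  have hw0 : w ≠ 0 := by rintro h; rw [h] at hw_im; simp at hw_im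
  have hdet : (a : ℂ) * d - b * c = 1 := by
    have := det_eq_one' γ
    rw [hc] at this
    exact_mod_cast this
  -- `τ = -32c/w ∈ ℍ`
  set τ : ℂ := -32 * c / w with hτ
  have hτ_im : 0 < τ.im := by
    rw [hτ, show -32 * (c : ℂ) / w = ((-32 * c : ℝ) : ℂ) * w⁻¹ by push_cast; ring, Complex.mul_im]
    simp only [ofReal_re, ofReal_im, zero_mul, add_zero, inv_im]
    have : 0 < Complex.normSq w := Complex.normSq_pos.mpr hw0
    have : (-32 * (c : ℝ)) * (-w.im / Complex.normSq w) = 32 * c * (w.im / Complex.normSq w) := by ring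
    rw [this]
    positivity
  have hτ0 : τ ≠ 0 := by rintro h; rw [h] at hτ_im; simp at hτ_im
  have hIτ : -I * τ = 32 * I * c / w := by rw [hτ]; field_simp
  have hinvτ : -1 / τ = w / (32 * c) := by rw [hτ]; field_simp
  have hinvτ' : τ⁻¹ = -(w / (32 * c)) := by rw [hτ]; field_simp
  -- the coordinate of `γ • z`
  have hγz : ((γ • z : ℍ) : ℂ) = a / c - 1 / (c * w) := by
    rw [coe_smul_eq', ← ha, ← hb, ← hd, hc]
    push_cast
    rw [moebius_eq_sub_inv' hc0 hdet hw0]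
  -- exponentials on the class `n = m (4c) + r`
  have hexp : ∀ (m : ℤ) (r : ℕ),
      cexp (2 * Real.pi * I * ((m * ((4 * c : ℕ) : ℤ) + r : ℤ) : ℂ) ^ 2 * ((γ • z : ℍ) : ℂ)) =
        cexp (2 * Real.pi * I * ((4 * a * r ^ 2 : ℤ) : ℂ) / ((4 * c : ℕ) : ℂ)) *
          cexp (Real.pi * I * τ * (m + (r : ℂ) / ((4 * c : ℕ) : ℂ)) ^ 2) := by
    intro m r
    rw [← Complex.exp_add, hγz]
    refine cexp_eq_cexp_of_sub_eq (a * (16 * m ^ 2 * c + 8 * m * r)) ?_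
    rw [hτ]
    push_cast
    field_simp
    ring
  have hchi : ∀ (m : ℤ) (r : ℕ), chiM4 (m * ((4 * c : ℕ) : ℤ) + r) = chiM4 r := by
    intro m r
    rw [show (m * ((4 * c : ℕ) : ℤ) + r : ℤ) = r + 4 * (m * c) by push_cast; ring]
    exact chiM4_add_four_mul _ _
  have hterm : ∀ (m : ℤ) (r : ℕ), thetaChiTerm (γ • z) (m * ((4 * c : ℕ) : ℤ) + r) =
      chiM4 r * ((4 * c : ℕ) : ℂ) * cexp (2 * Real.pi * I * ((4 * a * r ^ 2 : ℤ) : ℂ) / ((4 * c : ℕ) : ℂ)) *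
        ((m + (r : ℂ) / ((4 * c : ℕ) : ℂ)) * cexp (Real.pi * I * τ * (m + (r : ℂ) / ((4 * c : ℕ) : ℂ)) ^ 2)) := by
    intro m r
    rw [thetaChiTerm, hchi, hexp]
    have h4c : ((4 * c : ℕ) : ℂ) ≠ 0 := by exact_mod_cast (NeZero.ne (4 * c))
    push_cast at h4c ⊢
    field_simp
  -- Poisson summation on each class
  have hfib : ∀ r : Fin (4 * c), HasSum (fun m : ℤ ↦ thetaChiTerm (γ • z) (m * ((4 * c : ℕ) : ℤ) + (r : ℕ)))
      (chiM4 (r : ℕ) * ((4 * c : ℕ) : ℂ) * cexp (2 * Real.pi * I * ((4 * a * (r : ℕ) ^ 2 : ℤ) : ℂ) / ((4 * c : ℕ) : ℂ)) *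
        (1 / (-I * τ) ^ (1 / 2 : ℂ) * τ⁻¹ * (1 / (2 * Real.pi * I)) *
          jacobiTheta₂' ((r : ℕ) / ((4 * c : ℕ) : ℂ)) (-1 / τ))) := by
    intro r
    simp_rw [hterm]
    exact (hasSum_linear_mul_cexp_sq_add hτ_im _).mul_left _
  -- reindex `ℤ` by `Fin (4c) × ℤ`
  have htot := hasSum_thetaChi (γ • z)
  let e : Fin (4 * c) × ℤ ≃ ℤ := (Equiv.prodComm _ _).trans (Int.divModEquiv (4 * c)).symm
  have he : ∀ p : Fin (4 * c) × ℤ, e p = p.2 * ((4 * c : ℕ) : ℤ) + (p.1 : ℕ) := fun p ↦ rfl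
  rw [← e.hasSum_iff] at htot
  have htot' : HasSum (fun p : Fin (4 * c) × ℤ ↦ thetaChiTerm (γ • z) (p.2 * ((4 * c : ℕ) : ℤ) + (p.1 : ℕ)))
      (thetaChi (γ • z)) := by
    convert htot using 2 with p
    rw [Function.comp_apply, he]
  have hsum := htot'.prod_fiberwise hfib
  rw [← (hasSum_fintype _).unique hsum]
  simp_rw [hIτ, hinvτ, hinvτ']
  have hw2 : 0 < (w / (32 * c)).im := by
    rw [show w / (32 * c) = w / ((32 * c : ℝ) : ℂ) by norm_cast, Complex.div_ofReal_im]
    positivity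
  have hk : ∀ r : Fin (4 * c), HasSum (fun k : ℤ ↦
      chiM4 (r : ℕ) * ((4 * c : ℕ) : ℂ) * cexp (2 * Real.pi * I * ((4 * a * (r : ℕ) ^ 2 : ℤ) : ℂ) / ((4 * c : ℕ) : ℂ)) *
        (1 / (32 * I * c / w) ^ (1 / 2 : ℂ) * -(w / (32 * c)) * (1 / (2 * Real.pi * I)) *
          jacobiTheta₂'_term k ((r : ℕ) / ((4 * c : ℕ) : ℂ)) (w / (32 * c))))
      (chiM4 (r : ℕ) * ((4 * c : ℕ) : ℂ) * cexp (2 * Real.pi * I * ((4 * a * (r : ℕ) ^ 2 : ℤ) : ℂ) / ((4 * c : ℕ) : ℂ)) *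
        (1 / (32 * I * c / w) ^ (1 / 2 : ℂ) * -(w / (32 * c)) * (1 / (2 * Real.pi * I)) *
          jacobiTheta₂' ((r : ℕ) / ((4 * c : ℕ) : ℂ)) (w / (32 * c)))) := by
    intro r
    exact ((hasSum_jacobiTheta₂'_term _ hw2).mul_left _).mul_left _
  have hK := hasSum_sum (s := (Finset.univ : Finset (Fin (4 * c)))) fun r _ ↦ hk r
  rw [← hK.tsum_eq, ← tsum_mul_left]
  refine tsum_congr fun k ↦ ?_
  rw [chiGaussSum_eq_sum_range, ← Fin.sum_univ_eq_sum_range, Finset.mul_sum, Finset.mul_sum]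
  refine Finset.sum_congr rfl fun r _ ↦ ?_
  rw [jacobiTheta₂'_term, jacobiTheta₂_term]
  have hπ : (2 * Real.pi * I : ℂ) ≠ 0 := by simp [Real.pi_ne_zero, I_ne_zero]
  have this : cexp (2 * Real.pi * I * ((4 * a * (r : ℕ) ^ 2 : ℤ) : ℂ) / ((4 * c : ℕ) : ℂ)) *
      cexp (2 * Real.pi * I * k * ((r : ℕ) / ((4 * c : ℕ) : ℂ)) + Real.pi * I * k ^ 2 * (w / (32 * c))) =
      cexp (Real.pi * I * k ^ 2 * (w / (32 * c))) *
        cexp (2 * Real.pi * I * (((4 * a : ℤ) * (r : ℕ) ^ 2 + k * (r : ℕ) : ℤ) : ℂ) / ((4 * c : ℕ) : ℂ)) := by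
    rw [← Complex.exp_add, ← Complex.exp_add]
    congr 1
    push_cast
    ring
  set Ea := cexp (2 * Real.pi * I * ((4 * a * (r : ℕ) ^ 2 : ℤ) : ℂ) / ((4 * c : ℕ) : ℂ)) with hEa
  set Ek := cexp (2 * Real.pi * I * k * ((r : ℕ) / ((4 * c : ℕ) : ℂ)) + Real.pi * I * k ^ 2 * (w / (32 * c))) with hEk
  set Ew := cexp (Real.pi * I * k ^ 2 * (w / (32 * c))) with hEw
  set Eak := cexp (2 * Real.pi * I * (((4 * a : ℤ) * (r : ℕ) ^ 2 + k * (r : ℕ) : ℤ) : ℂ) / ((4 * c : ℕ) : ℂ)) with hEak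
  set X := (1 / (32 * I * c / w) ^ (1 / 2 : ℂ)) with hX
  calc chiM4 (r : ℕ) * ((4 * c : ℕ) : ℂ) * Ea * (X * -(w / (32 * c)) * (1 / (2 * Real.pi * I)) * (2 * Real.pi * I * k * Ek))
      = chiM4 (r : ℕ) * ((4 * c : ℕ) : ℂ) * X * (-(w / (32 * c))) * ((1 / (2 * Real.pi * I)) * (2 * Real.pi * I))
          * k * (Ea * Ek) := by ring
    _ = chiM4 (r : ℕ) * ((4 * c : ℕ) : ℂ) * X * (-(w / (32 * c))) * 1 * k * (Ew * Eak) := by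
          rw [this, one_div_mul_cancel hπ]
    _ = -(w / 8) * X * (k * Ew * (chiM4 (r : ℕ) * Eak)) := by
          push_cast
          field_simp
          ring

end General

/-! ### B. Holomorphy and continuity of `Θ′` -/

/-- On `Im z ≥ y₀ > 0` the terms of `Θ′` are bounded by the summable `|n| e^{-2π y₀ n²}`. [folklore] -/
theorem norm_thetaChiTerm_le_of_le {y₀ : ℝ} {τ : ℂ} (hτ : y₀ ≤ τ.im) (n : ℤ) :
    ‖chiM4 n * n * cexp (2 * Real.pi * I * n ^ 2 * τ)‖ ≤
      ((|n| : ℤ) : ℝ) ^ 1 * Real.exp (-Real.pi * (2 * y₀ * n ^ 2 - 2 * 0 * ((|n| : ℤ) : ℝ))) := by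
  rw [Int.cast_abs, norm_mul, norm_mul, Complex.norm_exp]
  have hre : (2 * Real.pi * I * n ^ 2 * τ).re = -(2 * Real.pi * n ^ 2) * τ.im := by
    have : (2 * Real.pi * I * n ^ 2 * τ : ℂ) = ((2 * Real.pi * (n : ℝ) ^ 2 : ℝ) : ℂ) * (I * τ) := by
      push_cast; ring
    rw [this, Complex.re_ofReal_mul, Complex.I_mul_re]; ring
  rw [hre, Complex.norm_intCast, pow_one, mul_zero, zero_mul, sub_zero]
  have hexp : Real.exp (-(2 * Real.pi * n ^ 2) * τ.im) ≤ Real.exp (-Real.pi * (2 * y₀ * n ^ 2)) := by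
    apply Real.exp_le_exp.mpr
    have : 0 ≤ 2 * Real.pi * (n : ℝ) ^ 2 := by positivity
    nlinarith
  calc ‖chiM4 n‖ * |(n : ℝ)| * Real.exp (-(2 * Real.pi * n ^ 2) * τ.im)
      ≤ 1 * |(n : ℝ)| * Real.exp (-Real.pi * (2 * y₀ * n ^ 2)) := by
        gcongr
        exact norm_chiM4_le n
    _ = _ := by ring

/-- `Θ′ ∘ ofComplex` is holomorphic on the upper half-plane. [folklore] -/
theorem differentiableOn_thetaChi :
    DifferentiableOn ℂ (thetaChi ∘ UpperHalfPlane.ofComplex) {z : ℂ | 0 < z.im} := by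
  intro τ hτ
  have hτ' : 0 < τ.im := hτ
  have hy₀p : 0 < τ.im / 2 := by positivity
  have hUo : IsOpen {z : ℂ | τ.im / 2 < z.im} := isOpen_lt continuous_const Complex.continuous_im
  have hτU : τ ∈ {z : ℂ | τ.im / 2 < z.im} := by
    simp only [Set.mem_setOf_eq]; linarith
  -- each term is entire
  have hterm : ∀ n : ℤ, Differentiable ℂ (fun z : ℂ ↦ chiM4 n * n * cexp (2 * Real.pi * I * n ^ 2 * z)) :=
    fun n ↦ (differentiable_const (chiM4 n * (n : ℂ))).mul
      (((differentiable_const (2 * Real.pi * I * (n : ℂ) ^ 2)).mul differentiable_id).cexp)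
  -- on the half-plane `Im z > Im τ / 2` the series converges uniformly
  have hdiff : DifferentiableOn ℂ (fun z : ℂ ↦ ∑' n : ℤ, chiM4 n * n * cexp (2 * Real.pi * I * n ^ 2 * z))
      {z : ℂ | τ.im / 2 < z.im} :=
    Complex.differentiableOn_tsum_of_summable_norm
      (summable_pow_mul_jacobiTheta₂_term_bound 0 (by positivity : (0 : ℝ) < 2 * (τ.im / 2)) 1)
      (fun n ↦ (hterm n).differentiableOn) hUo
      (fun n z (hz : τ.im / 2 < z.im) ↦ norm_thetaChiTerm_le_of_le (le_of_lt hz) n)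
  have heq : Set.EqOn (thetaChi ∘ UpperHalfPlane.ofComplex)
      (fun z : ℂ ↦ ∑' n : ℤ, chiM4 n * n * cexp (2 * Real.pi * I * n ^ 2 * z)) {z : ℂ | τ.im / 2 < z.im} := by
    intro z hz
    have hz' : 0 < z.im := lt_trans hy₀p hz
    simp only [Function.comp_apply, thetaChi, thetaChiTerm]
    rw [UpperHalfPlane.ofComplex_apply_of_im_pos hz']
  exact ((hdiff.congr heq).differentiableAt (hUo.mem_nhds hτU)).differentiableWithinAt

/-- **`Θ′` is holomorphic on `ℍ`.** [folklore] -/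
theorem mdifferentiable_thetaChi : MDifferentiable 𝓘(ℂ) 𝓘(ℂ) thetaChi :=
  UpperHalfPlane.mdifferentiable_iff.mpr differentiableOn_thetaChi

/-- `Θ′` is continuous. [folklore] -/
theorem continuous_thetaChi : Continuous thetaChi := mdifferentiable_thetaChi.continuous

/-! ### C. Theta-automorphy of weight `3/2` on `Γ₀(64)` -/

/-- `Θ′(z + n) = Θ′(z)`. [folklore] -/
theorem thetaChi_vadd_intCast (n : ℤ) (z : ℍ) : thetaChi (((n : ℝ)) +ᵥ z) = thetaChi z := by
  unfold thetaChi
  refine tsum_congr fun m ↦ ?_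
  unfold thetaChiTerm
  rw [UpperHalfPlane.coe_vadd]
  push_cast
  rw [show 2 * (Real.pi : ℂ) * I * m ^ 2 * ((n : ℂ) + z) =
      2 * Real.pi * I * m ^ 2 * z + ((m ^ 2 * n : ℤ) : ℂ) * (2 * Real.pi * I) by push_cast; ring,
    Complex.exp_add, Complex.exp_int_mul_two_pi_mul_I, mul_one]

/-- `d` is a unit modulo `64` when odd. [folklore] -/
theorem isUnit_zmod64_of_odd {d : ℤ} (hd : Odd d) : IsUnit ((d : ℤ) : ZMod 64) := by
  rw [ZMod.coe_int_isUnit_iff_isCoprime]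
  have h2 : IsCoprime (2 : ℤ) d := by
    obtain ⟨k, rfl⟩ := hd
    exact ⟨-k, 1, by ring⟩
  have := h2.pow_left (m := 6)
  norm_num at this
  exact this

/-- The sign: `-χ₋₄(-d) = χ₋₄(d)` written as the `if` of `thetaFactor_sq`. [folklore] -/
theorem neg_chiM4_neg_eq_if {d : ℤ} (hd : Odd d) :
    -(((ZMod.χ₄ (-((d : ℤ) : ZMod 4))) : ℤ) : ℂ) = (if d % 4 = 3 then -1 else 1) := by
  have h2 : d % 2 = 1 := Int.odd_iff.mp hd
  have hcases : d % 4 = 1 ∨ d % 4 = 3 := by omega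
  rcases hcases with h | h
  · rw [if_neg (by omega), ← ZMod.intCast_mod d 4, show d % ((4 : ℕ) : ℤ) = 1 by exact_mod_cast h]
    rw [show ZMod.χ₄ (-((1 : ℤ) : ZMod 4)) = -1 by decide]; push_cast; ring
  · rw [if_pos h, ← ZMod.intCast_mod d 4, show d % ((4 : ℕ) : ℤ) = 3 by exact_mod_cast h]
    rw [show ZMod.χ₄ (-((3 : ℤ) : ZMod 4)) = 1 by decide]; push_cast; ring

/-- **The law for `c > 0`**: `Θ′(γz) θ(z)³ = θ(γz)³ Θ′(z)` for `γ ∈ Γ₀(64)` with `c > 0`. [folklore] -/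
theorem thetaChi_law_of_pos {γ : SL(2, ℤ)} (hγ : γ ∈ Gamma0 64) (hpos : 0 < (γ 1 0 : ℤ)) (z : ℍ) :
    thetaChi (γ • z) * shimuraTheta z ^ 3 = shimuraTheta (γ • z) ^ 3 * thetaChi z := by
  obtain ⟨c, hc⟩ : ∃ c : ℕ, (γ 1 0 : ℤ) = c := ⟨(γ 1 0 : ℤ).toNat, (Int.toNat_of_nonneg hpos.le).symm⟩
  haveI : NeZero c := ⟨by rintro rfl; simp at hc; omega⟩
  have h64 : (64 : ℤ) ∣ γ 1 0 := by
    have h0 : ((γ 1 0 : ℤ) : ZMod 64) = 0 := Gamma0_mem.mp hγ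
    exact (ZMod.intCast_zmod_eq_zero_iff_dvd _ 64).mp h0
  have h64c : 64 ∣ c := by rw [hc] at h64; exact_mod_cast h64
  have hγ4 : γ ∈ Gamma0 4 := mem_Gamma0_four_of_dvd (by norm_num) hγ
  have hd : Odd (γ 1 1 : ℤ) := odd_d_of_mem_Gamma0 hγ4
  have M := thetaChi_smul_mul_theta hc h64c z
  have S := shimuraTheta_sq_smul hγ4 z
  rw [hc] at S
  have hs := neg_chiM4_neg_eq_if hd
  rw [← hs] at S
  linear_combination (shimuraTheta z ^ 2) * M - (shimuraTheta (γ • z) * thetaChi z) * S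

/-- The coordinate of `γ z` for `c = 0`: `γ z = z + a b` (`a = d = ±1`). [folklore] -/
theorem smul_eq_vadd_of_c_eq_zero {γ : SL(2, ℤ)} (h0 : (γ 1 0 : ℤ) = 0) (z : ℍ) :
    γ • z = ((((γ 0 0 : ℤ) * γ 0 1 : ℤ) : ℝ)) +ᵥ z := by
  have hdet := det_eq_one' γ
  rw [h0, mul_zero, sub_zero] at hdet
  rcases Int.eq_one_or_neg_one_of_mul_eq_one hdet with ha | ha
  · have hd : (γ 1 1 : ℤ) = 1 := by rw [ha] at hdet; linarith
    apply UpperHalfPlane.ext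
    rw [coe_smul_eq', UpperHalfPlane.coe_vadd, h0, ha, hd]
    push_cast; ring
  · have hd : (γ 1 1 : ℤ) = -1 := by rw [ha] at hdet; linarith
    apply UpperHalfPlane.ext
    rw [coe_smul_eq', UpperHalfPlane.coe_vadd, h0, ha, hd]
    push_cast; field_simp; ring

/-- **`Θ′` is theta-automorphic of weight `3/2`, level `64`, trivial character.**
[cite: Shimura1973HalfIntegral, §2 Prop. 2.2] -/
theorem isThetaAutomorphic_thetaChi : IsThetaAutomorphic 3 64 1 thetaChi := by
  intro γ hγ z
  have hγ4 : γ ∈ Gamma0 4 := mem_Gamma0_four_of_dvd (by norm_num) hγ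
  have hd : Odd (γ 1 1 : ℤ) := odd_d_of_mem_Gamma0 hγ4
  rw [MulChar.one_apply (isUnit_zmod64_of_odd hd), one_mul]
  rcases lt_trichotomy (γ 1 0 : ℤ) 0 with hneg | hzero | hpos
  · -- `c < 0`: use `-γ`
    have hγ' : -γ ∈ Gamma0 64 := neg_mem_Gamma0 hγ
    have hpos' : 0 < ((-γ) 1 0 : ℤ) := by rw [SL_neg_apply]; linarith
    have := thetaChi_law_of_pos hγ' hpos' z
    rwa [ModularGroup.SL_neg_smul] at this
  · -- `c = 0`
    rw [smul_eq_vadd_of_c_eq_zero hzero z, thetaChi_vadd_intCast, shimuraTheta_vadd_intCast]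
    ring
  · exact thetaChi_law_of_pos hγ hpos z

/-! ### D. Cusp decay: `Θ′(gz)²/(cz+d)³ → 0` at `i∞` for every `g ∈ SL₂(ℤ)` -/

/-- A tail bound: `∑_k |k| B e^{-α k² y} ≤ B e^{-α y} C(α)` for `y ≥ 1`. [folklore] -/
theorem tsum_abs_mul_exp_le {α : ℝ} (hα : 0 < α) {y : ℝ} (hy : 1 ≤ y) :
    (Summable fun k : ℤ ↦ (|k| : ℝ) * Real.exp (-α * k ^ 2 * y)) ∧
    ∑' k : ℤ, (|k| : ℝ) * Real.exp (-α * k ^ 2 * y) ≤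
      Real.exp (-α * y) * (Real.exp α * ∑' k : ℤ, ((|k| : ℤ) : ℝ) ^ 1 *
        Real.exp (-Real.pi * (α / Real.pi * k ^ 2 - 2 * 0 * ((|k| : ℤ) : ℝ)))) := by
  have hS := summable_pow_mul_jacobiTheta₂_term_bound 0 (by positivity : 0 < α / Real.pi) 1
  -- termwise: `|k| e^{-α k² y} ≤ e^{-α y} e^{α} |k| e^{-α k²}` (`k² y ≥ k² + y - 1` for `|k| ≥ 1`)
  have hterm : ∀ k : ℤ, (|k| : ℝ) * Real.exp (-α * k ^ 2 * y) ≤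
      Real.exp (-α * y) * (Real.exp α * (((|k| : ℤ) : ℝ) ^ 1 *
        Real.exp (-Real.pi * (α / Real.pi * k ^ 2 - 2 * 0 * ((|k| : ℤ) : ℝ))))) := by
    intro k
    rw [Int.cast_abs, pow_one, mul_zero, zero_mul, sub_zero,
      show -Real.pi * (α / Real.pi * (k : ℝ) ^ 2) = -α * k ^ 2 by field_simp]
    rcases eq_or_ne k 0 with rfl | hk
    · simp
    · have hk1 : (1 : ℝ) ≤ (k : ℝ) ^ 2 := by
        have : (1 : ℤ) ≤ k ^ 2 := by nlinarith [Int.one_le_abs hk, sq_abs k]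
        exact_mod_cast this
      have key : Real.exp (-α * k ^ 2 * y) ≤ Real.exp (-α * y) * (Real.exp α * Real.exp (-α * k ^ 2)) := by
        rw [← Real.exp_add, ← Real.exp_add]
        apply Real.exp_le_exp.mpr
        nlinarith [mul_nonneg hα.le (mul_nonneg (sub_nonneg.mpr hk1) (sub_nonneg.mpr hy))]
      calc (|(k : ℝ)|) * Real.exp (-α * k ^ 2 * y)
          ≤ |(k : ℝ)| * (Real.exp (-α * y) * (Real.exp α * Real.exp (-α * k ^ 2))) :=
            mul_le_mul_of_nonneg_left key (abs_nonneg _)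
        _ = _ := by ring
  have hS' : Summable fun k : ℤ ↦ Real.exp (-α * y) * (Real.exp α * (((|k| : ℤ) : ℝ) ^ 1 *
      Real.exp (-Real.pi * (α / Real.pi * k ^ 2 - 2 * 0 * ((|k| : ℤ) : ℝ))))) :=
    (hS.mul_left _).mul_left _
  have hsum : Summable fun k : ℤ ↦ (|k| : ℝ) * Real.exp (-α * k ^ 2 * y) :=
    Summable.of_nonneg_of_le (fun k ↦ by positivity) hterm hS'
  refine ⟨hsum, ?_⟩
  calc ∑' k : ℤ, (|k| : ℝ) * Real.exp (-α * k ^ 2 * y)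
      ≤ ∑' k : ℤ, Real.exp (-α * y) * (Real.exp α * (((|k| : ℤ) : ℝ) ^ 1 *
          Real.exp (-Real.pi * (α / Real.pi * k ^ 2 - 2 * 0 * ((|k| : ℤ) : ℝ))))) :=
        hsum.tsum_le_tsum hterm hS'
    _ = _ := by rw [tsum_mul_left, tsum_mul_left]

/-- `‖x^{1/2}‖ = ‖x‖^{1/2}`. [folklore] -/
theorem norm_cpow_half (x : ℂ) : ‖x ^ (1 / 2 : ℂ)‖ = ‖x‖ ^ (1 / 2 : ℝ) := by
  rw [show (1 / 2 : ℂ) = ((1 / 2 : ℝ) : ℂ) by push_cast; ring, Complex.norm_cpow_real]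

/-- **`Θ′(gz)` decays like `|cz+d|^{3/2} e^{-π Im z/32}`** for `g` with `c > 0`. [folklore] -/
theorem norm_thetaChi_smul_le {c : ℕ} [NeZero c] {g : SL(2, ℤ)} (hc : (g 1 0 : ℤ) = c) :
    ∃ C : ℝ, ∀ z : ℍ, 32 ≤ z.im →
      ‖thetaChi (g • z)‖ ≤ C * ‖(c : ℂ) * z + g 1 1‖ ^ (3 / 2 : ℝ) * Real.exp (-(Real.pi / 32) * z.im) := by
  set C₁ : ℝ := Real.exp (Real.pi / 32) * ∑' k : ℤ, ((|k| : ℤ) : ℝ) ^ 1 *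
    Real.exp (-Real.pi * ((Real.pi / 32) / Real.pi * k ^ 2 - 2 * 0 * ((|k| : ℤ) : ℝ))) with hC₁
  refine ⟨(1 / 8) * (1 / (32 * c)) ^ (1 / 2 : ℝ) * (4 * c) * C₁, fun z hz ↦ ?_⟩
  have hcR : (0 : ℝ) < c := Nat.cast_pos.mpr (Nat.pos_of_ne_zero (NeZero.ne c))
  set w : ℂ := (c : ℂ) * z + g 1 1 with hw
  have hw_im : 0 < w.im := im_denom_pos (g 1 1) z
  have hwim : w.im = c * z.im := by rw [hw]; simp
  have hw0 : w ≠ 0 := by rintro h; rw [h] at hw_im; simp at hw_im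
  rw [thetaChi_smul_eq_tsum_general hc z, ← hw]
  -- the norm of the prefactor
  have hX : ‖(1 / (32 * I * c / w) ^ (1 / 2 : ℂ))‖ = (1 / (32 * c)) ^ (1 / 2 : ℝ) * ‖w‖ ^ (1 / 2 : ℝ) := by
    rw [norm_div, norm_one, norm_cpow_half, norm_div, norm_mul, norm_mul, Complex.norm_I, mul_one,
      Complex.norm_ofNat, Complex.norm_natCast, Real.div_rpow (by positivity) (norm_nonneg _),
      Real.div_rpow zero_le_one (by positivity), Real.one_rpow]
    have h1 : 0 < ‖w‖ ^ (1 / 2 : ℝ) := Real.rpow_pos_of_pos (norm_pos_iff.mpr hw0) _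
    have h2 : 0 < (32 * (c : ℝ)) ^ (1 / 2 : ℝ) := Real.rpow_pos_of_pos (by positivity) _
    field_simp
  -- the series
  have hy : 1 ≤ z.im / 32 := by linarith
  have hα : (0 : ℝ) < Real.pi / 32 * 32 := by positivity
  obtain ⟨hsumK, hK⟩ := tsum_abs_mul_exp_le (α := Real.pi / 32) (by positivity) (y := z.im) (by linarith)
  have hterm : ∀ k : ℤ, ‖(k : ℂ) * cexp (Real.pi * I * k ^ 2 * (w / (32 * c))) *
      chiGaussSum (c := 4 * c) four_dvd_four_mul ((4 * g 0 0 : ℤ) : ZMod (4 * c)) k‖ ≤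
      (4 * c) * ((|k| : ℝ) * Real.exp (-(Real.pi / 32) * k ^ 2 * z.im)) := by
    intro k
    rw [norm_mul, norm_mul, Complex.norm_intCast, Complex.norm_exp]
    have hre : (Real.pi * I * k ^ 2 * (w / (32 * c))).re = -(Real.pi / 32) * k ^ 2 * z.im := by
      have : (Real.pi * I * k ^ 2 * (w / (32 * c)) : ℂ) = ((Real.pi * (k : ℝ) ^ 2 / (32 * c) : ℝ) : ℂ) * (I * w) := by
        push_cast; field_simp
      rw [this, Complex.re_ofReal_mul, Complex.I_mul_re, hwim]
      field_simp
    rw [hre]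
    have hG := norm_chiGaussSum_le (c := 4 * c) four_dvd_four_mul ((4 * g 0 0 : ℤ) : ZMod (4 * c)) k
    calc |(k : ℝ)| * Real.exp (-(Real.pi / 32) * k ^ 2 * z.im) *
        ‖chiGaussSum (c := 4 * c) four_dvd_four_mul ((4 * g 0 0 : ℤ) : ZMod (4 * c)) k‖
        ≤ |(k : ℝ)| * Real.exp (-(Real.pi / 32) * k ^ 2 * z.im) * ((4 * c : ℕ) : ℝ) :=
          mul_le_mul_of_nonneg_left hG (by positivity)
      _ = _ := by push_cast; ring
  have hnormsum : Summable fun k : ℤ ↦ ‖(k : ℂ) * cexp (Real.pi * I * k ^ 2 * (w / (32 * c))) *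
      chiGaussSum (c := 4 * c) four_dvd_four_mul ((4 * g 0 0 : ℤ) : ZMod (4 * c)) k‖ :=
    Summable.of_nonneg_of_le (fun _ ↦ norm_nonneg _) hterm (hsumK.mul_left _)
  have hS : ‖∑' k : ℤ, (k : ℂ) * cexp (Real.pi * I * k ^ 2 * (w / (32 * c))) *
      chiGaussSum (c := 4 * c) four_dvd_four_mul ((4 * g 0 0 : ℤ) : ZMod (4 * c)) k‖ ≤
      (4 * c) * (Real.exp (-(Real.pi / 32) * z.im) * C₁) := by
    refine (norm_tsum_le_tsum_norm hnormsum).trans ?_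
    calc ∑' k : ℤ, ‖(k : ℂ) * cexp (Real.pi * I * k ^ 2 * (w / (32 * c))) *
          chiGaussSum (c := 4 * c) four_dvd_four_mul ((4 * g 0 0 : ℤ) : ZMod (4 * c)) k‖
        ≤ ∑' k : ℤ, (4 * c) * ((|k| : ℝ) * Real.exp (-(Real.pi / 32) * k ^ 2 * z.im)) :=
          Summable.tsum_le_tsum hterm hnormsum (hsumK.mul_left _)
      _ = (4 * c) * ∑' k : ℤ, (|k| : ℝ) * Real.exp (-(Real.pi / 32) * k ^ 2 * z.im) := tsum_mul_left
      _ ≤ (4 * c) * (Real.exp (-(Real.pi / 32) * z.im) * C₁) := by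
          refine mul_le_mul_of_nonneg_left ?_ (by positivity)
          rw [hC₁]; exact hK
  -- assemble
  rw [norm_mul, norm_mul, norm_neg, norm_div, Complex.norm_ofNat, hX]
  have hwn : 0 < ‖w‖ := norm_pos_iff.mpr hw0
  have h32 : ‖w‖ * ‖w‖ ^ (1 / 2 : ℝ) = ‖w‖ ^ (3 / 2 : ℝ) := by
    rw [show (3 / 2 : ℝ) = 1 + 1 / 2 by norm_num, Real.rpow_add hwn, Real.rpow_one]
  calc ‖w‖ / 8 * ((1 / (32 * c)) ^ (1 / 2 : ℝ) * ‖w‖ ^ (1 / 2 : ℝ)) *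
        ‖∑' k : ℤ, (k : ℂ) * cexp (Real.pi * I * k ^ 2 * (w / (32 * c))) *
          chiGaussSum (c := 4 * c) four_dvd_four_mul ((4 * g 0 0 : ℤ) : ZMod (4 * c)) k‖
      ≤ ‖w‖ / 8 * ((1 / (32 * c)) ^ (1 / 2 : ℝ) * ‖w‖ ^ (1 / 2 : ℝ)) *
          ((4 * c) * (Real.exp (-(Real.pi / 32) * z.im) * C₁)) :=
        mul_le_mul_of_nonneg_left hS (by positivity)
    _ = (1 / 8) * (1 / (32 * c)) ^ (1 / 2 : ℝ) * (4 * c) * C₁ * (‖w‖ * ‖w‖ ^ (1 / 2 : ℝ)) *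
          Real.exp (-(Real.pi / 32) * z.im) := by ring
    _ = _ := by rw [h32]

/-- **Cusp decay for `c > 0`**: `Θ′(gz)²/(cz+d)³ → 0` at `i∞`. [folklore] -/
theorem isZeroAtImInfty_slashSq_thetaChi_of_pos {g : SL(2, ℤ)} (hpos : 0 < (g 1 0 : ℤ)) :
    IsZeroAtImInfty (slashSq 3 thetaChi g) := by
  obtain ⟨c, hc⟩ : ∃ c : ℕ, (g 1 0 : ℤ) = c := ⟨(g 1 0 : ℤ).toNat, (Int.toNat_of_nonneg hpos.le).symm⟩
  haveI : NeZero c := ⟨by rintro rfl; simp at hc; omega⟩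
  obtain ⟨C, hC⟩ := norm_thetaChi_smul_le hc
  have hC0 : 0 ≤ C := by
    have h := hC (UpperHalfPlane.mk (32 * I) (by simp)) (by simp [UpperHalfPlane.im])
    have hw : 0 < ‖(c : ℂ) * (UpperHalfPlane.mk (32 * I) (by simp) : ℍ) + g 1 1‖ ^ (3 / 2 : ℝ) *
        Real.exp (-(Real.pi / 32) * (UpperHalfPlane.mk (32 * I) (by simp) : ℍ).im) := by
      have : (c : ℂ) * (UpperHalfPlane.mk (32 * I) (by simp) : ℍ) + g 1 1 ≠ 0 := by
        have := im_denom_pos (c := c) (g 1 1) (UpperHalfPlane.mk (32 * I) (by simp))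
        intro h0; rw [h0] at this; simp at this
      positivity
    nlinarith [norm_nonneg (thetaChi (g • UpperHalfPlane.mk (32 * I) (by simp)))]
  rw [isZeroAtImInfty_iff]
  intro ε hε
  -- choose `A` with `C² e^{-π A/16} ≤ ε`
  obtain ⟨A₀, hA₀⟩ : ∃ A₀ : ℝ, ∀ y, A₀ ≤ y → C ^ 2 * Real.exp (-(Real.pi / 16) * y) ≤ ε := by
    have ht : Tendsto (fun y : ℝ ↦ C ^ 2 * Real.exp (-(Real.pi / 16) * y)) atTop (𝓝 (C ^ 2 * 0)) := by
      refine Tendsto.const_mul _ ?_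
      have : Tendsto (fun y : ℝ ↦ -(Real.pi / 16) * y) atTop atBot := by
        refine Filter.Tendsto.const_mul_atTop_of_neg ?_ tendsto_id
        have := Real.pi_pos; linarith
      exact Real.tendsto_exp_atBot.comp this
    rw [mul_zero] at ht
    have := (ht.eventually (Iic_mem_nhds hε))
    rw [Filter.eventually_atTop] at this
    obtain ⟨A₀, hA₀⟩ := this
    exact ⟨A₀, fun y hy ↦ hA₀ y hy⟩
  refine ⟨max A₀ 32, fun z hz ↦ ?_⟩
  have hz32 : 32 ≤ z.im := le_trans (le_max_right _ _) hz
  have hzA : A₀ ≤ z.im := le_trans (le_max_left _ _) hz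
  rw [norm_slashSq]
  have hden : denom (g : GL (Fin 2) ℝ) z = (c : ℂ) * z + g 1 1 := by
    rw [ModularGroup.denom_apply, hc]; push_cast; ring
  rw [hden]
  set w : ℂ := (c : ℂ) * z + g 1 1 with hw
  have hw_im : 0 < w.im := im_denom_pos (g 1 1) z
  have hw0 : w ≠ 0 := by rintro h; rw [h] at hw_im; simp at hw_im
  have hwn : 0 < ‖w‖ := norm_pos_iff.mpr hw0
  have h1 := hC z hz32
  rw [← hw] at h1
  have h2 : ‖thetaChi (g • z)‖ ^ 2 ≤ (C * ‖w‖ ^ (3 / 2 : ℝ) * Real.exp (-(Real.pi / 32) * z.im)) ^ 2 :=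
    pow_le_pow_left₀ (norm_nonneg _) h1 2
  have h3 : (‖w‖ ^ (3 / 2 : ℝ)) ^ 2 = ‖w‖ ^ 3 := by
    rw [← Real.rpow_natCast, ← Real.rpow_mul hwn.le]; norm_num
  calc ‖thetaChi (g • z)‖ ^ 2 / ‖w‖ ^ 3
      ≤ (C * ‖w‖ ^ (3 / 2 : ℝ) * Real.exp (-(Real.pi / 32) * z.im)) ^ 2 / ‖w‖ ^ 3 :=
        div_le_div_of_nonneg_right h2 (by positivity)
    _ = C ^ 2 * (Real.exp (-(Real.pi / 32) * z.im)) ^ 2 := by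
        rw [mul_pow, mul_pow, h3]; field_simp
    _ = C ^ 2 * Real.exp (-(Real.pi / 16) * z.im) := by
        rw [← Real.exp_nat_mul]; congr 1; push_cast; ring
    _ ≤ ε := hA₀ _ hzA

/-- `Θ′ → 0` at `i∞` (no constant term). [folklore] -/
theorem isZeroAtImInfty_thetaChi : IsZeroAtImInfty thetaChi := by
  -- `|Θ′(z)| ≤ ∑ |n| e^{-2π n² y} ≤ e^{-2πy} C` for `y ≥ 1`
  rw [isZeroAtImInfty_iff]
  intro ε hε
  set C₁ : ℝ := Real.exp (2 * Real.pi) * ∑' k : ℤ, ((|k| : ℤ) : ℝ) ^ 1 *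
    Real.exp (-Real.pi * ((2 * Real.pi) / Real.pi * k ^ 2 - 2 * 0 * ((|k| : ℤ) : ℝ))) with hC₁
  obtain ⟨A₀, hA₀⟩ : ∃ A₀ : ℝ, ∀ y, A₀ ≤ y → Real.exp (-(2 * Real.pi) * y) * C₁ ≤ ε := by
    have ht : Tendsto (fun y : ℝ ↦ Real.exp (-(2 * Real.pi) * y) * C₁) atTop (𝓝 (0 * C₁)) := by
      refine Tendsto.mul_const _ ?_
      have : Tendsto (fun y : ℝ ↦ -(2 * Real.pi) * y) atTop atBot := by
        refine Filter.Tendsto.const_mul_atTop_of_neg ?_ tendsto_id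
        have := Real.pi_pos; linarith
      exact Real.tendsto_exp_atBot.comp this
    rw [zero_mul] at ht
    have := (ht.eventually (Iic_mem_nhds hε))
    rw [Filter.eventually_atTop] at this
    obtain ⟨A₀, hA₀⟩ := this
    exact ⟨A₀, fun y hy ↦ hA₀ y hy⟩
  refine ⟨max A₀ 1, fun z hz ↦ ?_⟩
  have hz1 : 1 ≤ z.im := le_trans (le_max_right _ _) hz
  obtain ⟨hsum, hK⟩ := tsum_abs_mul_exp_le (α := 2 * Real.pi) (by positivity) hz1
  have hterm : ∀ n : ℤ, ‖thetaChiTerm z n‖ ≤ (|n| : ℝ) * Real.exp (-(2 * Real.pi) * n ^ 2 * z.im) := by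
    intro n
    rw [thetaChiTerm, norm_mul, norm_mul, Complex.norm_intCast, Complex.norm_exp]
    have hre : (2 * Real.pi * I * n ^ 2 * (z : ℂ)).re = -(2 * Real.pi) * n ^ 2 * z.im := by
      have : (2 * Real.pi * I * n ^ 2 * (z : ℂ) : ℂ) = ((2 * Real.pi * (n : ℝ) ^ 2 : ℝ) : ℂ) * (I * z) := by
        push_cast; ring
      rw [this, Complex.re_ofReal_mul, Complex.I_mul_re, UpperHalfPlane.coe_im]; ring
    rw [hre]
    calc ‖chiM4 n‖ * |(n : ℝ)| * Real.exp (-(2 * Real.pi) * n ^ 2 * z.im)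
        ≤ 1 * |(n : ℝ)| * Real.exp (-(2 * Real.pi) * n ^ 2 * z.im) := by
          gcongr; exact norm_chiM4_le n
      _ = _ := by ring
  calc ‖thetaChi z‖ ≤ ∑' n : ℤ, ‖thetaChiTerm z n‖ := norm_tsum_le_tsum_norm (summable_thetaChiTerm z).norm
    _ ≤ ∑' n : ℤ, (|n| : ℝ) * Real.exp (-(2 * Real.pi) * n ^ 2 * z.im) :=
        (summable_thetaChiTerm z).norm.tsum_le_tsum hterm hsum
    _ ≤ Real.exp (-(2 * Real.pi) * z.im) * C₁ := by rw [hC₁]; exact hK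
    _ ≤ ε := hA₀ _ (le_trans (le_max_left _ _) hz)

/-- **Cusp decay of `Θ′` at every cusp**: `Θ′(gz)²/(cz+d)³ → 0` at `i∞` for all `g ∈ SL₂(ℤ)`. [folklore] -/
theorem isZeroAtImInfty_slashSq_thetaChi (g : SL(2, ℤ)) : IsZeroAtImInfty (slashSq 3 thetaChi g) := by
  rcases lt_trichotomy (g 1 0 : ℤ) 0 with hneg | hzero | hpos
  · -- `c < 0`: `slashSq 3 f g = -slashSq 3 f (-g)`
    have hpos' : 0 < ((-g) 1 0 : ℤ) := by
      rw [SL_neg_apply]; linarith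
    have h := isZeroAtImInfty_slashSq_thetaChi_of_pos hpos'
    have heq : slashSq 3 thetaChi g = -slashSq 3 thetaChi (-g) := by
      funext z
      simp only [slashSq, Pi.neg_apply, ModularGroup.SL_neg_smul]
      rw [ModularGroup.denom_apply, ModularGroup.denom_apply, SL_neg_apply,
        SL_neg_apply]
      push_cast
      rw [show (-((g 1 0 : ℤ) : ℂ)) * (z : ℂ) + -((g 1 1 : ℤ) : ℂ) = -(((g 1 0 : ℤ) : ℂ) * z + g 1 1) by ring,
        Odd.neg_pow (by decide : Odd 3), div_neg, neg_neg]
    rw [heq]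
    exact h.neg
  · -- `c = 0`: `Θ′(gz) = Θ′(z)` and `|denom| = 1`
    have h0 := isZeroAtImInfty_thetaChi
    rw [isZeroAtImInfty_iff] at h0 ⊢
    intro ε hε
    obtain ⟨A, hA⟩ := h0 (Real.sqrt ε) (Real.sqrt_pos.mpr hε)
    refine ⟨A, fun z hz ↦ ?_⟩
    rw [norm_slashSq, smul_eq_vadd_of_c_eq_zero hzero z, thetaChi_vadd_intCast]
    have hdet := det_eq_one' g
    rw [hzero, mul_zero, sub_zero] at hdet
    have hd : ‖denom (g : GL (Fin 2) ℝ) z‖ = 1 := by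
      rw [ModularGroup.denom_apply, hzero]
      rcases Int.eq_one_or_neg_one_of_mul_eq_one hdet with ha | ha
      · have : (g 1 1 : ℤ) = 1 := by rw [ha] at hdet; linarith
        rw [this]; simp
      · have : (g 1 1 : ℤ) = -1 := by rw [ha] at hdet; linarith
        rw [this]; simp
    rw [hd, one_pow, div_one]
    have := hA z hz
    calc ‖thetaChi z‖ ^ 2 ≤ Real.sqrt ε ^ 2 := pow_le_pow_left₀ (norm_nonneg _) this 2
      _ = ε := Real.sq_sqrt hε.le
  · exact isZeroAtImInfty_slashSq_thetaChi_of_pos hpos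

/-! ### E. Packaging: `Θ′ ∈ S_{3/2}(64, 1)`, `θ₄ ∈ M_{1/2}(64, 1)`, `φ₆₄ ∈ S_{4/2}(64, 1)`, the cusp form -/

/-- **`Θ′ ∈ S_{3/2}(64, 1)`.** [cite: Shimura1973HalfIntegral, §2 Prop. 2.2] -/
theorem thetaChi_mem_halfIntCuspForms : thetaChi ∈ halfIntCuspForms 3 64 1 :=
  ⟨mdifferentiable_thetaChi, isThetaAutomorphic_thetaChi, isZeroAtImInfty_slashSq_thetaChi⟩

/-- `θ₄` is theta-automorphic of weight `1/2`, level `64`, trivial character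
(`θ₄(γz) = j(γ,z) θ₄(z)` for `16 ∣ c`, `(4/|d|) = 1`). [cite: Tunnell1983Congruent, p. 326] -/
theorem isThetaAutomorphic_thetaMul_four_64 : IsThetaAutomorphic 1 64 1 (thetaMul 4) := by
  intro γ hγ z
  have h64 : (64 : ℤ) ∣ γ 1 0 := by
    have h0 : ((γ 1 0 : ℤ) : ZMod 64) = 0 := Gamma0_mem.mp hγ
    exact (ZMod.intCast_zmod_eq_zero_iff_dvd _ 64).mp h0
  have hγ4 : γ ∈ Gamma0 4 := mem_Gamma0_four_of_dvd (by norm_num) hγ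
  have hd : Odd (γ 1 1 : ℤ) := odd_d_of_mem_Gamma0 hγ4
  rw [thetaMul_smul (by norm_num : 0 < 4) ((show (4 * 4 : ℤ) ∣ 64 by norm_num).trans h64) z,
    shimuraTheta_smul_eq_thetaFactor (by norm_num : 4 ∣ 64) hγ z,
    MulChar.one_apply (isUnit_zmod64_of_odd hd),
    jacobiSym_eq_one_of_sq (Or.inr (Or.inl rfl)) (Int.natAbs_odd.mpr hd)]
  push_cast
  ring

/-- **`θ₄ ∈ M_{1/2}(64, 1)`.** [cite: Tunnell1983Congruent, p. 326] -/
theorem thetaMul_four_mem_halfIntModularForms_64 : thetaMul 4 ∈ halfIntModularForms 1 64 1 :=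
  ⟨mdifferentiable_thetaMul (by norm_num), isThetaAutomorphic_thetaMul_four_64,
    isBoundedAtImInfty_slashSq_thetaMul (by norm_num)⟩

/-- **`φ₆₄ = ½ Θ′ θ₄`** — the normalised newform of weight `2` and level `64` attached to the
congruent number curve `E₂ : 2y² = x³ - x` (64a); `= η(8z)⁸/(η(4z)²η(16z)²) = η(8z)³ θ(4z)`,
`q`-expansion `q + 2q⁵ - 3q⁹ - 6q¹³ + 2q¹⁷ - …`. [folklore] -/
def phi64 (z : ℍ) : ℂ := thetaChi z * thetaMul 4 z / 2

/-- `φ₆₄ ∈ S_{4/2}(64, 1)` (product of `Θ′ ∈ S_{3/2}` and `θ₄ ∈ M_{1/2}`). [folklore] -/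
theorem phi64_mem_halfIntCuspForms : phi64 ∈ halfIntCuspForms 4 64 1 := by
  have h := mul_mem_halfIntCuspForms thetaChi_mem_halfIntCuspForms thetaMul_four_mem_halfIntModularForms_64
  rw [one_mul_one_dirichlet] at h
  have h2 := (halfIntCuspForms 4 64 1).smul_mem (1 / 2 : ℂ) h
  convert h2 using 1
  funext z
  simp [phi64, div_eq_inv_mul, mul_comm]

/-- **`φ₆₄` as a weight-`2` cusp form on `Γ₀(64)`.** [folklore] -/
def phi64CuspForm : CuspForm (Gamma0 64) 2 :=
  cuspFormTwoOfMem (N := 64) (by norm_num) phi64 phi64_mem_halfIntCuspForms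

/-- The underlying function of `phi64CuspForm`. [folklore] -/
@[simp] theorem phi64CuspForm_apply (z : ℍ) : phi64CuspForm z = phi64 z := rfl

end Literature.NumberTheory.EllipticCurves.ModularForms
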